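import Literature.NumberTheory.EllipticCurves.BSDRootNumberSmallConductorAssemblyProofs
import Literature.NumberTheory.EllipticCurves.ComplexMultiplication
import Literature.NumberTheory.EllipticCurves.ComplexMultiplicationHasCMProofs
import Literature.NumberTheory.EllipticCurves.Rank1Residual.Predicates
import HarnessLib

/-!
# Hu–Shu–Yin 2019, Thm. 1.4: the `3`-part of BSD for the PRODUCT `E_p × E_{3p²}` of cube-sum curves (`p ≡ 4, 7 mod 9`, `3` not a cube mod `p`), and the COMBINATION with Burungale–Flach 2024 giving `BSD(E_p, 3)` for the rank-one curve `E_p : x³ + y³ = p`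

HONEST FRAMING (cell `b2b-bsdres`, run/shared/lean/b2b/bsd-rank1-residual/; harvest seat
`b2b-bsdres-harvest-1`, gen 2): prove what is provable now; shrink each hard class to its core with
data; no claim beyond stated classes. The cell deletes the COMBINATION-SHAPED residual classes of
the BSD formula in analytic rank `≤ 1` from PUBLISHED theorems only and TYPES the
construction-shaped ones; this is not "finishing BSD". This file vendors ONE published theorem
(named fact, nothing asserted; D-0014) — a `3`-adic PRODUCT formula for a rank-one and a
rank-zero cube-sum curve — and PROVES the combination with a second published theorem already in
the tree (Burungale–Flach, Camb. J. Math. 12 (2024), Cor. 2: the full BSD formula for every CM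
curve over `ℚ` with `L(E,1) ≠ 0`, tree fact `bsdTriple_of_hasCM_of_L_one_ne_zero`) which isolates
the rank-one factor: `BSD(E_p, 3)` for `E_p : x³ + y³ = p`. Census: the RAMIFIED corner of the
construction-shaped class X12 (CM by `ℚ(√-3)`, rank `1`, `p = 3 ∣ N`; 98 classes in census v5,
26 of them cube-sum curves); reach of this file = the classes **441b** (`E_7`), **4563b** (`E_13`),
**16641a** (`E_43`) — `7 ≡ 7`, `13 ≡ 4`, `43 ≡ 7 (mod 9)` and `3` is not a cube modulo `7`, `13`,
`43` (cubes mod `7`: `{0, ±1}`; mod `13`: `{0, ±1, ±5}`; `3¹⁴ ≡ 36 (mod 43)`). FAMILY-shaped: the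
label of X12 does not change. Companion files: `KezukaLi2020/CubeSumThreePart.lean` (`2p`, `2p²`),
`ShuYin2022/CubeSumThreePThreePart.lean` (`3p`, `3p²`, which reuses this file's combination step).

Source (arXiv text read this session, `paper:arxiv-1708.05266`; journal: Trans. Amer. Math. Soc.
372 (2019), no. 10, 6905–6925, doi:10.1090/tran/7760 [HuShuYin2019]). Y. Hu, J. Shu, H. Yin, *An
explicit Gross–Zagier formula related to the Sylvester conjecture*.

* Notation (p. 4): "For any `n ∈ ℚ^×`, the elliptic curve `E_n` [`: x³ + y³ = n`] has Weierstrass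
  equation `y² = x³ − 432n²` and has complex multiplication by `𝒪_K` over `K` [`= ℚ(√-3)`]."
  (`cubeSumCurve n` below.) p. 3: "`Ω_p` denote the minimal real period of `E_p`, `ĥ(·)` the
  Néron–Tate height of `E_p` over `ℚ` and `c_ℓ` the Tamagawa number of `E_p` at a prime `ℓ`. From
  [DV17], we know that `E_p(ℚ)` resp. `E_{3p²}(ℚ)` has rank `1` resp. `0`. Let `P` be a generator
  of the free part of `E_p(ℚ)`." p. 4: "By the work [DV17], we know that `L(s, E_p)` has a zero
  of order `1` at `s = 1` and `L(1, E_{3p²}) ≠ 0`." ([DV17] = S. Dasgupta, J. Voight, *Sylvester's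
  problem and mock Heegner points*, Proc. AMS 146 (2018).)
* **Theorem 1.3** (p. 3, "known", from [DV17], Gross–Zagier, Kolyvagin, Perrin-Riou, Kobayashi,
  Li–Liu–Tian): "Let `p ≡ 4, 7 mod 9` be a rational prime number such that `3 mod p` is not a cubic
  residue. Then 1. `ord_{s=1} L(s, E_p) = rk_ℤ E_p(ℚ) = 1`; 2. The Tate-Shafarevich group `Ш(E_p)`
  is finite, and for any prime `ℓ ∤ 6`, the `ℓ`-part of `|Ш(E_p)|` is as predicted by the
  [BSD formula] for `E_p`."
* Display (bsd1) (p. 3): `|Ш(E_p)|·|Ш(E_{3p²})| = L'(1,E_p)/(Ω_p·ĥ_ℚ(P)) · L(1,E_{3p²})/Ω_{3p²} ·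
  |E_p(ℚ)_tor|²/∏_ℓ c_ℓ(E_p) · |E_{3p²}(ℚ)_tor|²/∏_ℓ c_ℓ(E_{3p²})`.
* **Theorem 1.4** (p. 3, VERBATIM): "Let `p ≡ 4, 7 mod 9` be a rational prime number such that
  `3 mod p` is not a cubic residue. Then the both sides of (bsd1) are nonzero rational numbers and
  the exponents of `3` in both sides of (bsd1) are equal as expected."
* Proof of Theorem 1.4 (§5, arXiv pp. 12–13): Prop. 5.2 (Satgé's `3`-isogeny Selmer groups):
  `dim_{𝔽₃} Sel₃(E_p(ℚ)) ≤ 1`, `dim_{𝔽₃} Sel₃(E_{3p²}(ℚ)) = 0`; "By Proposition 5.2, `E_p` being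
  rank `1`, and the exact sequence `0 → E(ℚ)/3E(ℚ) → Sel₃(E(ℚ)) → Ш(E)[3] → 0`, we know directly
  that `|Ш(E_p)[3^∞]| = |Ш(E_{3p²})[3^∞]| = 1`"; the `3`-adic valuation of the right side is then
  computed to be `0` from the explicit Gross–Zagier formula (Thm. 1.5) and the `3`-indivisibility
  of the Heegner point ("`ĥ_ℚ(P) = u ĥ_ℚ(R)` for some `u ∈ ℤ₃^× ∩ ℚ`"). Status: PUB (refereed, 2019).

Transcription (tree dictionary of `BSDRootNumberSmallConductorProofs`: Miller's `#Ш_an = shaAn W` =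
`L^{(r)}(E,1)/r! · #E(ℚ)_tor² / (Ω · ∏ c_ℓ · Reg)` with `r = r_an`; `BSD(E,p) = BSDp W p`): `B` is
any globally minimal model `ℚ`-isomorphic to `E_p : y² = x³ − 432p²` and `A` any globally minimal
model `ℚ`-isomorphic to `E_{3p²} : y² = x³ − 432·(3p²)²`; "`3 mod p` not a cubic residue" =
`¬ ∃ x : ZMod p, x³ = 3`. Conclusions transcribed: `rk B = 1 = r_an(B)`, `Ш(B)` finite (Thm. 1.3);
`rk A = 0 = r_an(A)` (p. 3–4); `Ш(A)[3^∞]`, `Ш(B)[3^∞]` trivial (§5); "both sides of (bsd1) are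
nonzero rationals with equal exponent of `3`" = `#Ш_an(B) = q_B`, `#Ш_an(A) = q_A` rational with
`q_B q_A ≠ 0` and `ord₃(q_B q_A) = ord₃(#Ш(B)[3^∞] · #Ш(A)[3^∞]) = 0` (the right side of (bsd1) is
exactly `#Ш_an(E_p) · #Ш_an(E_{3p²})` in Miller's currency: `r! = 1`, `Reg(E_p) = ĥ(P)`,
`Reg(E_{3p²}) = 1`; Miller's period `∫_{E(ℝ)}|ω|` and the paper's "minimal real period" agree up
to a power of `2`, invisible at `3`). Nothing weaker or stronger is transcribed. No `_holds`
expected (mock Heegner points, explicit Gross–Zagier on `X_0(3^5)`, Waldspurger periods are not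
in Mathlib); consumers take `(h : thm14_threePart_product)`.

The COMBINATION (proved here, `bsdp_three_of_threePart_product`): `A` has `j = 0` (`c₄ = 0` is
invariant under `VariableChange`), hence CM (`WeierstrassCurve.hasCM_of_j_eq_zero`, proved in the
tree), and `L(A,1) ≠ 0` (`r_an = 0`, modularity `hmod`); Burungale–Flach's Cor. 2 in the tree's
form (`hCM0 : bsdTriple_of_hasCM_of_L_one_ne_zero`, with `forall_bsdp_of_bsdTriple'`) gives
`BSD(A,3)`, i.e. `ord₃ #Ш_an(A) = ord₃ #Ш(A)[3^∞] = 0`; so `ord₃ #Ш_an(B) = 0 = ord₃ #Ш(B)[3^∞]`,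
which with `rk B = r_an(B)` is `BSD(B,3)`.

Census identification (Cremona `allcurves`, checked this session): `E_7 ≅ 441b2 = [0,0,1,0,-331]`,
`E_13 ≅ 4563b2 = [0,0,1,0,-1141]`, `E_43 ≅ 16641a2 = [0,0,1,0,-12481]` via
`(x, y) ↦ (x/4, y/8 − 1/2)` (`variableChange_cremona_eq_cubeSumCurve` below proves the three
equations); the census records `441b1`, `4563b1`, `16641a1` are the `3`-isogenous curves
(`Wuthrich2014.bsdp_of_isIsogenous`, a lane step, as is global minimality of the `b2`/`a2` models).

## References
* [HuShuYin2019] Y. Hu, J. Shu, H. Yin, Trans. Amer. Math. Soc. 372 (2019) 6905–6925 = arXiv:1708.05266, Thm. 1.3, (bsd1), Thm. 1.4 (p. 3), p. 4, §5 (Prop. 5.2 and the proof of Thm. 1.4).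
* S. Dasgupta, J. Voight, *Sylvester's problem and mock Heegner points*, Proc. Amer. Math. Soc. 146 (2018) 3257–3273 (HSY's [DV17]).
* [BurungaleFlach2024] A. Burungale, M. Flach, Camb. J. Math. 12 (2024), Thm. 1.1 and Cor. 2 (tree `bsdTriple_of_hasCM_of_L_one_ne_zero`).
* [Miller2011LMS] R. L. Miller, LMS J. Comput. Math. 14 (2011), §1 and Def. 1.1; RESIDUAL-CASES.md §a.2 X12; HOME/b2b-bsdres-harvest-1/HARVEST.md row C13, RECLASSIFY.md (gen-2 addendum).
-/

noncomputable section

open scoped Classical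

open WeierstrassCurve Literature.NumberTheory.EllipticCurves
  Literature.NumberTheory.EllipticCurves.Rank1Residual

namespace Literature.NumberTheory.EllipticCurves.HuShuYin2019

/-- The cube-sum curve `E_n : x³ + y³ = n` in the Weierstrass form used by Hu–Shu–Yin (and
Shu–Yin 2022): `y² = x³ − 432 n²`. [cite: HuShuYin2019, p. 4 ("E_n has Weierstrass equation y² = x³ − 432n²")] -/
def cubeSumCurve (n : ℚ) : WeierstrassCurve ℚ :=
  ⟨0, 0, 0, 0, -432 * n ^ 2⟩

/-- `c₄(E_n) = 0` (all of `a₁, a₂, a₃, a₄` vanish). [folklore] -/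
theorem cubeSumCurve_c₄ (n : ℚ) : (cubeSumCurve n).c₄ = 0 := by
  simp [cubeSumCurve, WeierstrassCurve.c₄, WeierstrassCurve.b₂, WeierstrassCurve.b₄]

/-- A curve `ℚ`-isomorphic to `E_n` has `c₄ = 0` (`c₄` scales by `u⁻⁴` under a variable change),
hence `j = 0`. [folklore] -/
theorem c₄_eq_zero_of_variableChange_eq {W : WeierstrassCurve ℚ} {n : ℚ}
    (hW : ∃ C : VariableChange ℚ, C • W = cubeSumCurve n) : W.c₄ = 0 := by
  obtain ⟨C, hC⟩ := hW
  have h : (C • W).c₄ = ((C.u⁻¹ : ℚˣ) : ℚ) ^ 4 * W.c₄ := WeierstrassCurve.variableChange_c₄ W C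
  rw [hC, cubeSumCurve_c₄] at h
  have hu : ((C.u⁻¹ : ℚˣ) : ℚ) ^ 4 ≠ 0 := pow_ne_zero _ (Units.ne_zero _)
  rcases mul_eq_zero.mp h.symm with h0 | h0
  · exact absurd h0 hu
  · exact h0

/-- A curve `ℚ`-isomorphic to `E_n` has `j = 0`, so it has (geometric) complex multiplication
(by `ℤ[ζ₃]`; tree theorem `WeierstrassCurve.hasCM_of_j_eq_zero`). [folklore] -/
theorem hasCM_of_variableChange_eq {W : WeierstrassCurve ℚ} [W.IsElliptic] {n : ℚ}
    (hW : ∃ C : VariableChange ℚ, C • W = cubeSumCurve n) : W.HasCM :=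
  WeierstrassCurve.hasCM_of_j_eq_zero W (W.j_eq_zero (c₄_eq_zero_of_variableChange_eq hW))

/-- **The combination step (PROVED): a `3`-adic product formula for (rank-zero CM `A`) × (`B`)
plus Burungale–Flach 2024 for `A` gives `BSD(B,3)`.** Inputs: `hCM0` = Burungale–Flach Cor. 2 in
the tree's geometric-CM form (`bsdTriple_of_hasCM_of_L_one_ne_zero`), `hmod` = modularity
(`hasEntireLFunction_rat`, for `r_an(A) = 0 ⇒ L(A,1) ≠ 0`); data: `A` CM with `r_an(A) = 0`,
`rk B = r_an(B)`, `Ш(A)[3^∞]` and `Ш(B)[3^∞]` finite and trivial, `#Ш_an(A) = q_A`, `#Ш_an(B) = q_B`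
rational with `q_B q_A ≠ 0` and `ord₃(q_B q_A) = 0`. Then `BSD(A,3)` (from `hCM0`) reads
`ord₃ q_A = ord₃ #Ш(A)[3^∞] = 0`, so `ord₃ q_B = 0 = ord₃ #Ш(B)[3^∞]`.
[cite: BurungaleFlach2024, Cor. 2] [cite: Miller2011LMS, §1 and Def. 1.1] -/
theorem bsdp_three_of_threePart_product (hCM0 : bsdTriple_of_hasCM_of_L_one_ne_zero)
    (hmod : hasEntireLFunction_rat) (A B : WeierstrassCurve ℚ) [A.IsElliptic] [A.IsGloballyMinimal]
    [B.IsElliptic] [B.IsGloballyMinimal] (hAcm : A.HasCM) (hA0 : A.analyticRank = 0)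
    (hB : B.mordellWeilRank = B.analyticRank)
    (hAtriv : Nat.card (AddCommGroup.primaryComponent A.sha 3) = 1)
    (hBfin : Finite (AddCommGroup.primaryComponent B.sha 3))
    (hBtriv : Nat.card (AddCommGroup.primaryComponent B.sha 3) = 1)
    {qA qB : ℚ} (hqA : shaAn A = (qA : ℂ)) (hqB : shaAn B = (qB : ℂ)) (hne : qB * qA ≠ 0)
    (hv : padicValRat 3 (qB * qA) = 0) : BSDp B 3 := by
  haveI : Fact (Nat.Prime 3) := ⟨Nat.prime_three⟩
  have hL : A.entireLFunction 1 ≠ 0 := (A.analyticRank_eq_zero_iff_holds (hmod A)).1 hA0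
  have hT : A.BSDTriple := hCM0 A hAcm hL
  obtain ⟨-, -, qA', hqA', hvA'⟩ := forall_bsdp_of_bsdTriple' A hT 3 Nat.prime_three
  have hqq : qA' = qA := by exact_mod_cast hqA'.symm.trans hqA
  rw [hqq, hAtriv] at hvA'
  simp only [padicValNat_one_right, Nat.cast_zero] at hvA'
  obtain ⟨hqB0, hqA0⟩ := mul_ne_zero_iff.mp hne
  have hvB : padicValRat 3 qB = 0 := by
    rw [padicValRat.mul hqB0 hqA0, hvA', add_zero] at hv
    exact hv
  refine ⟨hB, hBfin, qB, hqB, ?_⟩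
  rw [hvB, hBtriv]
  simp only [padicValNat_one_right, Nat.cast_zero]

/-- **Hu–Shu–Yin, Trans. AMS 372 (2019), Thm. 1.4** (with the parts of Thm. 1.3 and §5 it rests on;
verbatim in the module docstring): for a prime `p ≡ 4, 7 mod 9` such that `3 mod p` is not a cubic
residue, with `E_p : x³ + y³ = p` (`y² = x³ − 432p²`) and `E_{3p²}` (`y² = x³ − 432(3p²)²`):
`ord_{s=1} L(s,E_p) = rk E_p(ℚ) = 1` and `Ш(E_p)` finite (Thm. 1.3); `rk E_{3p²}(ℚ) = 0` and
`L(1,E_{3p²}) ≠ 0` (pp. 3–4); `|Ш(E_p)[3^∞]| = |Ш(E_{3p²})[3^∞]| = 1` (§5); and "the both sides of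
(bsd1) [`|Ш(E_p)|·|Ш(E_{3p²})| = L'(1,E_p)/(Ω_p ĥ(P)) · L(1,E_{3p²})/Ω_{3p²} · |tor|²/∏c ·
|tor|²/∏c`] are nonzero rational numbers and the exponents of `3` in both sides of (bsd1) are
equal" (Thm. 1.4). Transcription (module docstring): `B` ≅ `E_p`, `A` ≅ `E_{3p²}` globally
minimal; the right side of (bsd1) is `#Ш_an(B) · #Ш_an(A)` (Miller). FAMILY-shaped; census reach:
classes 441b, 4563b, 16641a (with Burungale–Flach 2024, `bsdp_three_of_thm14`). STATUS PUB.
[cite: HuShuYin2019, Thm. 1.3, (bsd1) and Thm. 1.4 (p. 3), p. 4, §5 (Prop. 5.2, proof of Thm. 1.4)] [cite: Miller2011LMS, §1 and Def. 1.1] -/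
def thm14_threePart_product : Prop :=
  ∀ (p : ℕ), p.Prime → (p % 9 = 4 ∨ p % 9 = 7) → (¬ ∃ x : ZMod p, x ^ 3 = 3) →
    ∀ (A B : WeierstrassCurve ℚ) [A.IsElliptic] [A.IsGloballyMinimal]
      [B.IsElliptic] [B.IsGloballyMinimal],
      (∃ C : VariableChange ℚ, C • B = cubeSumCurve (p : ℚ)) →
      (∃ C : VariableChange ℚ, C • A = cubeSumCurve (3 * (p : ℚ) ^ 2)) →
      B.mordellWeilRank = 1 ∧ B.analyticRank = 1 ∧ Finite B.sha ∧
      A.mordellWeilRank = 0 ∧ A.analyticRank = 0 ∧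
      Finite (AddCommGroup.primaryComponent A.sha 3) ∧
      Nat.card (AddCommGroup.primaryComponent A.sha 3) = 1 ∧
      Nat.card (AddCommGroup.primaryComponent B.sha 3) = 1 ∧
      ∃ qB qA : ℚ, shaAn B = (qB : ℂ) ∧ shaAn A = (qA : ℂ) ∧ qB * qA ≠ 0 ∧
        padicValRat 3 (qB * qA) = 0

/-- **Thm. 1.4 + Burungale–Flach 2024 ⇒ `BSD(E_p, 3)`** for the rank-one Sylvester curve
`E_p : x³ + y³ = p` (`p ≡ 4, 7 mod 9`, `3` not a cube mod `p`), for any globally minimal model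
`B ≅ E_p`, given a globally minimal model `A ≅ E_{3p²}` of the rank-zero partner (which exists for
every curve over `ℚ`; supplying it is the lane's certificate). Standing named facts: `hCM0`
(Burungale–Flach Cor. 2, tree form), `hmod` (modularity). Census: classes 441b (`p = 7`), 4563b
(`p = 13`), 16641a (`p = 43`).
[cite: HuShuYin2019, Thm. 1.4 (p. 3)] [cite: BurungaleFlach2024, Cor. 2] [cite: Miller2011LMS, Def. 1.1] -/
theorem bsdp_three_of_thm14 (h : thm14_threePart_product)
    (hCM0 : bsdTriple_of_hasCM_of_L_one_ne_zero) (hmod : hasEntireLFunction_rat)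
    {p : ℕ} (hp : p.Prime) (h9 : p % 9 = 4 ∨ p % 9 = 7) (h3 : ¬ ∃ x : ZMod p, x ^ 3 = 3)
    (A B : WeierstrassCurve ℚ) [A.IsElliptic] [A.IsGloballyMinimal] [B.IsElliptic]
    [B.IsGloballyMinimal] (hB : ∃ C : VariableChange ℚ, C • B = cubeSumCurve (p : ℚ))
    (hA : ∃ C : VariableChange ℚ, C • A = cubeSumCurve (3 * (p : ℚ) ^ 2)) :
    B.analyticRank = 1 ∧ BSDp B 3 := by
  obtain ⟨hrk, hr, -, -, hA0, -, hAtriv, hBtriv, qB, qA, hqB, hqA, hne, hv⟩ :=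
    h p hp h9 h3 A B hB hA
  haveI : Fact (Nat.Prime 3) := ⟨Nat.prime_three⟩
  have hBfin : Finite (AddCommGroup.primaryComponent B.sha 3) :=
    Nat.finite_of_card_ne_zero (by rw [hBtriv]; exact one_ne_zero)
  exact ⟨hr, bsdp_three_of_threePart_product hCM0 hmod A B (hasCM_of_variableChange_eq hA) hA0
    (by rw [hrk, hr]) hAtriv hBfin hBtriv hqA hqB hne hv⟩

/-! ### Census identifications: the Cremona models `[0,0,1,0,a₆]` of `E_7`, `E_13`, `E_43` -/

/-- The variable change `(x, y) ↦ (x/4, y/8 − 1/2)` (`u = 1/2`, `r = s = 0`, `t = −1/2`) taking a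
model `y² + y = x³ + a₆` to `y² = x³ + 64·a₆ + 16`. [folklore] -/
def halfScale : VariableChange ℚ :=
  ⟨⟨(1 / 2 : ℚ), 2, by norm_num, by norm_num⟩, 0, 0, -1 / 2⟩

/-- `y² + y = x³ + a₆` becomes `y² = x³ + (64 a₆ + 16)` under `halfScale`. [folklore] -/
theorem halfScale_smul (a₆ : ℚ) :
    halfScale • (⟨0, 0, 1, 0, a₆⟩ : WeierstrassCurve ℚ) = ⟨0, 0, 0, 0, 64 * a₆ + 16⟩ := by
  ext <;> simp [halfScale, WeierstrassCurve.variableChange_a₁, WeierstrassCurve.variableChange_a₂,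
    WeierstrassCurve.variableChange_a₃, WeierstrassCurve.variableChange_a₄,
    WeierstrassCurve.variableChange_a₆] <;> ring

/-- Census identification: Cremona `441b2 = [0,0,1,0,-331]`, `4563b2 = [0,0,1,0,-1141]` and
`16641a2 = [0,0,1,0,-12481]` are `ℚ`-isomorphic to `E_7`, `E_13`, `E_43` respectively
(`64·(−331) + 16 = −21168 = −432·7²`, `64·(−1141) + 16 = −73008 = −432·13²`,
`64·(−12481) + 16 = −798768 = −432·43²`). [folklore] -/
theorem variableChange_cremona_eq_cubeSumCurve :
    halfScale • (⟨0, 0, 1, 0, -331⟩ : WeierstrassCurve ℚ) = cubeSumCurve 7 ∧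
    halfScale • (⟨0, 0, 1, 0, -1141⟩ : WeierstrassCurve ℚ) = cubeSumCurve 13 ∧
    halfScale • (⟨0, 0, 1, 0, -12481⟩ : WeierstrassCurve ℚ) = cubeSumCurve 43 := by
  refine ⟨?_, ?_, ?_⟩ <;> rw [halfScale_smul] <;> simp only [cubeSumCurve] <;> norm_num

/-- `3` is not a cube modulo `7`, `13`, `43`, and `7 ≡ 7`, `13 ≡ 4`, `43 ≡ 7 (mod 9)`: the three
census primes satisfy the hypotheses of Thm. 1.4. [folklore] -/
theorem hypotheses_seven_thirteen_fortythree :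
    (7 % 9 = 4 ∨ 7 % 9 = 7) ∧ (¬ ∃ x : ZMod 7, x ^ 3 = 3) ∧
    (13 % 9 = 4 ∨ 13 % 9 = 7) ∧ (¬ ∃ x : ZMod 13, x ^ 3 = 3) ∧
    (43 % 9 = 4 ∨ 43 % 9 = 7) ∧ (¬ ∃ x : ZMod 43, x ^ 3 = 3) := by
  refine ⟨by decide, by decide, by decide, by decide, by decide, by decide⟩

end Literature.NumberTheory.EllipticCurves.HuShuYin2019
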